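/-
Copyright (c) 2026 The decomp-a2c cell. All rights reserved.
Released under Apache 2.0 license as described in the file LICENSE.
-/
import Summits.AtomisticToContinuum.Crystallization.Theorems.ChartedZeroExcessLayeredLatticeLiouvilleWI

/-!
# ChartedZeroExcessLayeredLatticeLiouville — part WJ «LayerSup»: the sup of a lattice field on one layer of an index cube from its layer sums of
  mixed in-plane differences (decomp-a2c-lens-2, g58; helper of stmt-AtomisticToContinuum-26636, leaf (LD′) `ModalLipschitzZ`; brick (4a)
  `ModalLipschitzAt`, vertical half (4a⊥), step (WJ) of the g58 plan)

Part WI bounds, for a harmonic field, the LAYER SUM over the `(2R+1)²` columns of a cube of the squared vertical increment across ONE gap.  To turn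
such layer sums into a POINTWISE bound without a logarithmic loss this part transports part VD's two-dimensional sup bound `planeSupBound` (the
discrete `W^{2,1} ⊂ L^∞` of the plane, in squared form) through part VE's chart `cubePt` onto the layer `k₀` of the index cube `idxBallF (γ₀, k₀) s`:

★ `layer_sup_sq_le`: for every lattice field `g` and every `X` of the layer,
  `(N+1)² ‖g X‖² ≤ 4 Σ_layer ‖g‖² + 4 (N+1)N (Σ_layer ‖D₁ g‖² + Σ_layer ‖D₂ g‖²) + 4 ((N+1)N)² Σ_layer ‖D₁ D₂ g‖²`, `N = 2⌊s⌋₊`,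
with `D₁, D₂` the in-plane unit differences.  Fed with `g = D₃ χ` for the harmonic fields `χ = D_E ψ, D₁ D_E ψ, D₂ D_E ψ, D₁ D₂ D_E ψ` (WI + WA's
Caccioppoli iterates) every right-hand term is `≍ E/n³`, i.e. the in-plane GRADIENT of the vertical gap increment is `≲ √(E/#ball)/n` pointwise — the
modulus brick (4a) needs (part WK).  Also here: recentring of index balls / energies (`idxBall_subset_of_dist`, `idxEnergy_le_of_dist`), the layer
count `card_layerSq_le`, and the rewriting `sum_layer_axis₃_eq` of layer sums of `D₃ χ` as WI's gap sums.
-/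

namespace Summit.AtomisticToContinuum.Crystallization.Theorems.ChartedZeroExcessLayeredLatticeLiouville

open Summit.AtomisticToContinuum.Crystallization.Theorems.ChartedPlanarOrderRigidityDoor (E3)
open Finset
open scoped InnerProductSpace RealInnerProductSpace BigOperators

noncomputable section LayerSup

variable {c : ℝ} {a b : E3} {w : ℤ → E3}

/-! ### WJ.1  Recentring -/

/-- a ball about a point of a ball sits in a concentric enlargement: `dist x₁ x₀ + m ≤ n → idxBall x₁ m ⊆ idxBall x₀ n`. [formal bookkeeping] -/
theorem idxBall_subset_of_dist {x₀ x₁ : Cell 2 × ℤ} {m n : ℝ} (h : dist x₁ x₀ + m ≤ n) : idxBall x₁ m ⊆ idxBall x₀ n := fun X hX => by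
  have h1 : dist X x₁ ≤ m := hX
  show dist X x₀ ≤ n
  linarith [dist_triangle X x₁ x₀]

/-- the energy on a recentred sub-ball is at most the energy. [formal bookkeeping] -/
theorem idxEnergy_le_of_dist (φ : Cell 2 → ℤ → E3) {x₀ x₁ : Cell 2 × ℤ} {m n : ℝ} (h : dist x₁ x₀ + m ≤ n) :
    idxEnergy φ (idxBall x₁ m) ≤ idxEnergy φ (idxBall x₀ n) := by
  rw [← coe_idxBallF, ← coe_idxBallF, idxEnergy_coe_finset, idxEnergy_coe_finset]
  have hsub : idxBallF x₁ m ⊆ idxBallF x₀ n := fun X hX =>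
    mem_idxBallF.mpr (by linarith [dist_triangle X x₁ x₀, mem_idxBallF.mp hX])
  exact Finset.sum_le_sum_of_subset_of_nonneg (Finset.filter_subset_filter _ (Finset.product_subset_product hsub hsub))
    fun _ _ _ => sq_nonneg _

/-! ### WJ.2  The layer of an index cube through the chart -/

/-- a two-dimensional box sum through the chart at height index `⌊s⌋₊` (the layer `k₀`) is at most the layer sum (`G ≥ 0`). [formal bookkeeping] -/
theorem boxSum₂_le_layer (γ₀ : Cell 2) (k₀ : ℤ) {s : ℝ} (hs : 0 ≤ s) (G : Cell 2 × ℤ → ℝ) (hG : ∀ Y, 0 ≤ G Y) {sa sb : Finset ℕ}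
    (ha : sa ⊆ range (2 * ⌊s⌋₊ + 1)) (hb : sb ⊆ range (2 * ⌊s⌋₊ + 1)) :
    ∑ j ∈ sb, ∑ i ∈ sa, G (cubePt (γ₀, k₀) ⌊s⌋₊ i j ⌊s⌋₊) ≤ ∑ Y ∈ idxBallF (γ₀, k₀) s with Y.2 = k₀, G Y := by
  rw [← sum_product']
  refine sum_le_sum_of_injOn' (fun p : ℕ × ℕ => cubePt (γ₀, k₀) ⌊s⌋₊ p.2 p.1 ⌊s⌋₊) (fun p _ q _ h => ?_) (fun p hp => ?_) (fun Y _ => hG Y)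
    fun _ _ => le_rfl
  · obtain ⟨h1, h2, -⟩ := cubePt_inj h
    exact Prod.ext h2 h1
  · obtain ⟨hp1, hp2⟩ := mem_product.mp hp
    have h1 := mem_range.mp (hb hp1)
    have h2 := mem_range.mp (ha hp2)
    refine mem_filter.mpr ⟨cubePt_mem (γ₀, k₀) hs (by omega) (by omega) (by omega), ?_⟩
    have h := cubePt_sub_snd (γ₀, k₀) ⌊s⌋₊ p.2 p.1 ⌊s⌋₊
    rw [Prod.snd_sub] at h
    dsimp only at h
    omega

/-- the layer `k₀` of the cube `idxBallF (γ₀, k₀) s` has at most `(2⌊s⌋₊ + 1)²` sites. [formal bookkeeping] -/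
theorem card_layerSq_le (γ₀ : Cell 2) (k₀ : ℤ) (s : ℝ) : (#{Y ∈ idxBallF (γ₀, k₀) s | Y.2 = k₀} : ℝ) ≤ ((((2 * ⌊s⌋₊ : ℕ) : ℝ)) + 1) ^ 2 := by
  have hsub : {Y ∈ idxBallF (γ₀, k₀) s | Y.2 = k₀} ⊆
      (range (2 * ⌊s⌋₊ + 1) ×ˢ range (2 * ⌊s⌋₊ + 1)).image (fun p : ℕ × ℕ => cubePt (γ₀, k₀) ⌊s⌋₊ p.1 p.2 ⌊s⌋₊) := by
    intro Y hY
    obtain ⟨hY1, hY2⟩ := mem_filter.mp hY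
    obtain ⟨i, j, k, hi, hj, hk, rfl⟩ := exists_cubePt_eq hY1
    have hkR : k = ⌊s⌋₊ := by
      have h := cubePt_sub_snd (γ₀, k₀) ⌊s⌋₊ i j k
      rw [Prod.snd_sub, hY2] at h
      dsimp only at h
      omega
    subst hkR
    exact mem_image.mpr ⟨(i, j), mem_product.mpr ⟨mem_range.mpr (by omega), mem_range.mpr (by omega)⟩, rfl⟩
  have h := (card_le_card hsub).trans card_image_le
  rw [card_product, card_range] at h
  have h' : ((#{Y ∈ idxBallF (γ₀, k₀) s | Y.2 = k₀} : ℕ) : ℝ) ≤ ((2 * ⌊s⌋₊ + 1) * (2 * ⌊s⌋₊ + 1) : ℕ) := by exact_mod_cast h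
  refine h'.trans (le_of_eq ?_)
  push_cast
  ring

/-- layer sums of the vertical difference field `D₃ χ` are WI's gap sums. [formal bookkeeping] -/
theorem sum_layer_axis₃_eq (χ : Cell 2 → ℤ → E3) (L : Finset (Cell 2 × ℤ)) (k₀ : ℤ) (hL : ∀ Y ∈ L, Y.2 = k₀) :
    ∑ Y ∈ L, ‖latDiff idxAxis₃ χ Y.1 Y.2‖ ^ 2 = ∑ Y ∈ L, ‖χ Y.1 (k₀ + 1) - χ Y.1 k₀‖ ^ 2 :=
  sum_congr rfl fun Y hY => by rw [hL Y hY, latDiff_axis₃_apply]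

/-! ### WJ.3  ★ The layer sup bound -/

/-- ★ LAYER SUP BOUND (VD `planeSupBound` through the chart): for every lattice field `g` and every site `X` of the layer `k₀` of the cube
`idxBallF (γ₀, k₀) s` (`N = 2⌊s⌋₊`),
`(N+1)² ‖g X‖² ≤ 4 Σ_layer ‖g‖² + 4 (N+1)N Σ_layer ‖D₁ g‖² + 4 (N+1)N Σ_layer ‖D₂ g‖² + 4 ((N+1)N)² Σ_layer ‖D₁ D₂ g‖²` — the discrete `W^{2,1} ⊂ L^∞`
of the plane with only the MIXED second difference, no logarithm. [this file, g58] -/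
theorem layer_sup_sq_le (g : Cell 2 → ℤ → E3) (γ₀ : Cell 2) (k₀ : ℤ) {s : ℝ} (hs : 0 ≤ s) {X : Cell 2 × ℤ} (hX : X ∈ idxBallF (γ₀, k₀) s)
    (hX2 : X.2 = k₀) :
    ((((2 * ⌊s⌋₊ : ℕ) : ℝ)) + 1) ^ 2 * ‖g X.1 X.2‖ ^ 2 ≤
      4 * ∑ Y ∈ idxBallF (γ₀, k₀) s with Y.2 = k₀, ‖g Y.1 Y.2‖ ^ 2 +
      4 * ((((2 * ⌊s⌋₊ : ℕ) : ℝ) + 1) * ((2 * ⌊s⌋₊ : ℕ) : ℝ)) * ∑ Y ∈ idxBallF (γ₀, k₀) s with Y.2 = k₀, ‖latDiff idxAxis₁ g Y.1 Y.2‖ ^ 2 +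
      4 * ((((2 * ⌊s⌋₊ : ℕ) : ℝ) + 1) * ((2 * ⌊s⌋₊ : ℕ) : ℝ)) * ∑ Y ∈ idxBallF (γ₀, k₀) s with Y.2 = k₀, ‖latDiff idxAxis₂ g Y.1 Y.2‖ ^ 2 +
      4 * ((((2 * ⌊s⌋₊ : ℕ) : ℝ) + 1) * ((2 * ⌊s⌋₊ : ℕ) : ℝ)) ^ 2 *
        ∑ Y ∈ idxBallF (γ₀, k₀) s with Y.2 = k₀, ‖latDiff idxAxis₁ (latDiff idxAxis₂ g) Y.1 Y.2‖ ^ 2 := by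
  obtain ⟨i, j, k, hi, hj, hk, rfl⟩ := exists_cubePt_eq hX
  have hkR : k = ⌊s⌋₊ := by
    have h := cubePt_sub_snd (γ₀, k₀) ⌊s⌋₊ i j k
    rw [Prod.snd_sub, hX2] at h
    dsimp only at h
    omega
  subst hkR
  have hP := planeSupBound (fun i' j' k' => g (cubePt (γ₀, k₀) ⌊s⌋₊ i' j' k').1 (cubePt (γ₀, k₀) ⌊s⌋₊ i' j' k').2) hi hj ⌊s⌋₊
  simp only [fd₂_chart, fd₁_chart] at hP
  have hR := range_subset_range_succ (2 * ⌊s⌋₊)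
  have h0 := boxSum₂_le_layer γ₀ k₀ hs (fun Y => ‖g Y.1 Y.2‖ ^ 2) (fun _ => sq_nonneg _) Subset.rfl Subset.rfl
  have h1 := boxSum₂_le_layer γ₀ k₀ hs (fun Y => ‖latDiff idxAxis₁ g Y.1 Y.2‖ ^ 2) (fun _ => sq_nonneg _) hR Subset.rfl
  have h2 := boxSum₂_le_layer γ₀ k₀ hs (fun Y => ‖latDiff idxAxis₂ g Y.1 Y.2‖ ^ 2) (fun _ => sq_nonneg _) Subset.rfl hR
  have h3 := boxSum₂_le_layer γ₀ k₀ hs (fun Y => ‖latDiff idxAxis₁ (latDiff idxAxis₂ g) Y.1 Y.2‖ ^ 2) (fun _ => sq_nonneg _) hR hR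
  have hM : (0 : ℝ) ≤ (((2 * ⌊s⌋₊ : ℕ) : ℝ) + 1) * ((2 * ⌊s⌋₊ : ℕ) : ℝ) := by positivity
  exact hP.trans (add_le_add (add_le_add (add_le_add (mul_le_mul_of_nonneg_left h0 (by norm_num)) (mul_le_mul_of_nonneg_left h1 (by positivity)))
    (mul_le_mul_of_nonneg_left h2 (by positivity))) (mul_le_mul_of_nonneg_left h3 (by positivity)))

/-! ### WJ.4  The closed statement of this part -/

/-- The content of part WJ as one closed proposition: the layer sup bound. -/
def LayerSupShape : Prop :=
  ∀ (g : Cell 2 → ℤ → E3) (γ₀ : Cell 2) (k₀ : ℤ) (s : ℝ), 0 ≤ s → ∀ X : Cell 2 × ℤ, X ∈ idxBallF (γ₀, k₀) s → X.2 = k₀ →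
    ((((2 * ⌊s⌋₊ : ℕ) : ℝ)) + 1) ^ 2 * ‖g X.1 X.2‖ ^ 2 ≤
      4 * ∑ Y ∈ idxBallF (γ₀, k₀) s with Y.2 = k₀, ‖g Y.1 Y.2‖ ^ 2 +
      4 * ((((2 * ⌊s⌋₊ : ℕ) : ℝ) + 1) * ((2 * ⌊s⌋₊ : ℕ) : ℝ)) * ∑ Y ∈ idxBallF (γ₀, k₀) s with Y.2 = k₀, ‖latDiff idxAxis₁ g Y.1 Y.2‖ ^ 2 +
      4 * ((((2 * ⌊s⌋₊ : ℕ) : ℝ) + 1) * ((2 * ⌊s⌋₊ : ℕ) : ℝ)) * ∑ Y ∈ idxBallF (γ₀, k₀) s with Y.2 = k₀, ‖latDiff idxAxis₂ g Y.1 Y.2‖ ^ 2 +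
      4 * ((((2 * ⌊s⌋₊ : ℕ) : ℝ) + 1) * ((2 * ⌊s⌋₊ : ℕ) : ℝ)) ^ 2 *
        ∑ Y ∈ idxBallF (γ₀, k₀) s with Y.2 = k₀, ‖latDiff idxAxis₁ (latDiff idxAxis₂ g) Y.1 Y.2‖ ^ 2

/-- WJ holds. [this file, g58] -/
theorem layerSupShape_holds : LayerSupShape := fun g γ₀ k₀ _s hs _X hX hX2 => layer_sup_sq_le g γ₀ k₀ hs hX hX2

end LayerSup

end Summit.AtomisticToContinuum.Crystallization.Theorems.ChartedZeroExcessLayeredLatticeLiouville
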